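/-
Copyright (c) 2026. All rights reserved.
Released under Apache 2.0 license as described in the file LICENSE.
-/
import Literature.NumberTheory.Automorphic.EichlerOrderLocalConjugacy
import Literature.NumberTheory.Automorphic.BrandtMatrixRamified
import Literature.NumberTheory.Automorphic.BrandtModuleDictionary
import Literature.NumberTheory.Automorphic.BrandtOrderIdeals
import Literature.NumberTheory.Automorphic.QuaternionLocalRamified
import Literature.NumberTheory.Automorphic.BrandtDataTransport
import HarnessLib

/-!
# Right ideals with the same left order: the normaliser of a local maximal order, one-sided ideals at a ramified prime,
# and the fibres `{[I], [I P]}` of `[I] ↦ O_L(I)` for the maximal orders of the definite quaternion algebra of prime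
# discriminant (Voight Prop. 18.5.10 with 18.4.8 and 23.2.8; Vignéras II §1 Lemme 1.5, II §2 Thm. 2.3)

[tag: quaternion_algebra] [tag: class_number] [tag: maximal_order] [tag: ramification]

Topic `NumberTheory/Automorphic`; THEOREMS ONLY (no definition, no named fact, no instance; net Literature debt `0`).
Lane `lit-hodgefound`, seat p12, gen 50 — second file of the TYPE NUMBER series (companion of `BrandtTypeSet.lean`):
the fibres of the type map `Cls O → Typ O`, `[I] ↦ O_L(I)` (Voight Lemma 17.4.13 / Remark 17.4.15: «the fibers …
are given by classes of two-sided ideals: see Proposition 18.5.10»), for the maximal orders `O` of the definite quaternion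
algebra `B_{p,∞}` of prime discriminant `p`, where `Pic O ≅ ℤ/2ℤ` is generated by the unique prime `P` above `p`
(Voight 18.4.8, proof of Prop. 30.9.2). We prove the statement in the elementary form needed for Deuring's type number
formula: **two right `O`-ideals with the same left order differ, up to a rational factor, by `1` or by `P`**, so that every
fibre of the type map is an orbit `{c, [I_c P]}` of the Atkin–Lehner involution, and the Brandt matrix `T(p)` is the matrix of
that involution.

* §1 **`exists_units_smul_eq_central_of_conj_le`** — THE NORMALISER OF A LOCAL MAXIMAL ORDER AT A SPLIT PRIME: for a matrix model
  `Φ : B → M₂(ℚ_ℓ)` and `Λ = Φ⁻¹(M₂(ℤ_ℓ))`, a unit `γ` with `γ Λ γ⁻¹ ⊆ Λ` generates the CENTRAL ideal `γ Λ = ℓ^k Λ` (Smith normal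
  form `Φ(γ) = k₁ diag(s,t) k₂` from the tree's `Padic.exists_eq_mul_diagonal_mul`, and `‖s‖ = ‖t‖` by conjugating a `Φ(Λ)`-
  approximation of the matrix unit `E₀₁`, density `AlgHom.exists_norm_sub_le`) — Voight 23.2.8 `N(M₂(ℤ_p)) = ℚ_p^× GL₂(ℤ_p)`;
* §2 **`exists_units_smul_localAt_eq_central_of_ramified`** — at a ramified prime every `γ ∈ B^×` has `γ O₍ₚ₎ = p^a O₍ₚ₎` or
  `p^a P₍ₚ₎` according to the parity of `v_p(nrd γ)` (Vignéras II §1 Lemme 1.5: the ideals of the local maximal order are the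
  two-sided powers of `P`); `mem_localAt_iff_padicValRat_nonneg`, `units_smul_eq_units_smul_iff`;
* §3 **`Brandt.IsMaximalOrder.isMaximalOrder_leftOrder`** / `IsInvertibleRightIdeal.isMaximalZOrder_leftOrderOf` — the left order
  of a right ideal of a maximal order is maximal (Voight 17.4.3 / Lemma 17.4.11), `IsEichlerOrder.isMaximalZOrder_of_one`;
* §4 for a Brandt setup `S` of type `(1, p)` (`XiSetup.isMaximalZOrder`, `.hdivp`, `.hOp`, `.hnt`):
  `XiSetup.leftOrder_mul_normPrimeIdeal` (**`O_L(I P) = O_L(I)`**), `XiSetup.le_natCast_smul_of_localAt_le`,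
  **`XiSetup.exists_le_smul_or_le_mul_of_leftOrder_eq`** (the peeling step: `I' ⊊ I` with the same left order lies in `ℓ I` for
  a prime `ℓ` or in `I P`), **`XiSetup.exists_eq_smul_of_leftOrder_eq_of_le`** (`I' ⊆ I`, same left order ⟹ `I' = c I` or
  `I' = c I P`, `c ∈ ℕ`, by strong induction on `[I : I']`), **`XiSetup.exists_smul_eq_smul_of_leftOrder_eq`** (`m I' = c I` or
  `m I' = c I P` in general);
* §5 the involution `c ↦ [I_c P]` of `Cls O`: `XiSetup.mk_mul_normPrimeIdeal_congr` / `mk_rep_mk_mul_normPrimeIdeal` (well defined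
  on classes), **`XiSetup.mk_rep_mul_normPrimeIdeal_mul_normPrimeIdeal`** (an involution: `P² = pO`),
  `XiSetup.exists_leftOrder_rep_mk_mul_normPrimeIdeal_eq_conj` (it preserves the type),
  **`XiSetup.eq_or_eq_mk_mul_normPrimeIdeal_of_leftOrder_conj`** (THE FIBRES: `O_L(I_{c'}) ≃ O_L(I_c) ⟹ c' ∈ {c, [I_c P]}`),
  **`XiSetup.matrix_ramified_apply`** (`T(p)_{c c'} = [c = [I_{c'} P]]`, the tree's `BrandtData.ofOrder_T_ramified_apply`
  transported to `Brandt.matrix`), `XiSetup.matrix_ramified_diag` (`T(p)_{cc} = [[I_c P] = c]`).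

## Sources

* J. Voight, *Quaternion Algebras*, GTM 288 (2021): Lemma 17.4.11, Lemma 17.4.13, Remark 17.4.15, 18.4.8, **Prop. 18.5.10**,
  Cor. 18.5.12, 23.2.8, Thm. 13.3.11, and the proof of Prop. 30.9.2 («the unique right ideal `J ⊆ O` with `nrd(J) = p` … is
  automatically two-sided … `J` is principal if and only if there exists `α ∈ O` with `nrd(α) = p`»).
  [cite: Voight2021, Prop. 18.5.10, 18.4.8, 23.2.8, Thm. 13.3.11]
* M.-F. Vignéras, *Arithmétique des algèbres de quaternions*, LNM 800 (1980), Ch. I §4 Lemme 4.10; Ch. II §1 Lemme 1.4, Lemme 1.5,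
  Cor. 1.7; Ch. II §2 Lemme 2.2, Thm. 2.3, Lemme 2.4; Ch. III §5 exercice 5.8. [cite: VignerasLNM800, Ch. II §1 Lemme 1.5; Ch. II §2 Thm. 2.3; Ch. III §5 ex. 5.8]

## Scope (honest)

Theorems only. The classification is proved for the maximal orders of a definite quaternion algebra of PRIME discriminant
(setups of type `(1, p)`): `Idl(O') = ℚ^× {O', P'}` is rendered as «right ideals with the same left order are rational multiples
of `I` or of `I P`»; the groups `Idl`, `PIdl`, `Pic` are not introduced.
-- TODO(general form): squarefree discriminant `N⁻ = q₁ ⋯ q_r` (fibres = orbits of `(ℤ/2)^r`) and Eichler level `N⁺`.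
-/

noncomputable section


open scoped Matrix Pointwise

universe u

namespace Literature.NumberTheory.Automorphic

/-! ## §1 The normaliser of a local maximal order at a split prime -/

section SplitNormaliser

variable {B : Type u} [Ring B] [Algebra ℚ B] [IsQuaternionAlgebra ℚ B] {p : ℕ} [hp : Fact p.Prime]

/-- For `W ∈ GL₂(ℤ_p)` (integral entries, unit determinant), `W⁻¹ M` is integral iff `M` is. [cite: VignerasLNM800, Ch. II §2 Lemme 2.2] -/
theorem Padic.forall_norm_inv_mul_le_one_iff {W : Matrix (Fin 2) (Fin 2) ℚ_[p]}
    (hW : ∀ i j, ‖W i j‖ ≤ 1) (hWd : ‖W.det‖ = 1) (M : Matrix (Fin 2) (Fin 2) ℚ_[p]) :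
    (∀ i j, ‖(W⁻¹ * M) i j‖ ≤ 1) ↔ ∀ i j, ‖M i j‖ ≤ 1 := by
  have hd : W.det ≠ 0 := fun h => by rw [h, norm_zero] at hWd; exact zero_ne_one hWd
  have hdu : IsUnit W.det := isUnit_iff_ne_zero.mpr hd
  obtain ⟨hWi, -⟩ := Padic.integral_inv_of_norm_det_eq_one hW hWd
  refine ⟨fun h => ?_, fun h => Padic.norm_mul_apply_le_one hWi h⟩
  have e : M = W * (W⁻¹ * M) := by rw [← Matrix.mul_assoc, Matrix.mul_nonsing_inv _ hdu, Matrix.one_mul]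
  rw [e]
  exact Padic.norm_mul_apply_le_one hW h

/-- The `(0,1)` entry of `diag(s,t) Y diag(s,t)⁻¹` is `s Y₀₁ t⁻¹`. [cite: VignerasLNM800, Ch. II §2 Lemme 2.4] -/
theorem Padic.diag_mul_mul_diag_inv_apply_zero_one {s t : ℚ_[p]} (hs : s ≠ 0) (ht : t ≠ 0)
    (Y : Matrix (Fin 2) (Fin 2) ℚ_[p]) :
    ((!![s, 0; 0, t] : Matrix (Fin 2) (Fin 2) ℚ_[p]) * Y * (!![s, 0; 0, t])⁻¹) 0 1 = s * Y 0 1 * t⁻¹ := by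
  rw [Padic.diag_inv_eq hs ht]
  conv_lhs => rw [Matrix.eta_fin_two Y]
  simp

omit [IsQuaternionAlgebra ℚ B] hp in
/-- A central unit of `B`: `ν = q · 1` for `q ∈ ℚˣ`, commuting with every unit. [cite: Voight2021, 18.4.8 (principal two-sided ideals `qO`)] -/
theorem exists_units_val_eq_algebraMap {q : ℚ} (hq : q ≠ 0) :
    ∃ ν : Bˣ, (ν : B) = algebraMap ℚ B q ∧ ∀ α : Bˣ, α * ν = ν * α := by
  have hu : IsUnit (algebraMap ℚ B q) := (IsUnit.mk0 q hq).map _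
  refine ⟨hu.unit, hu.unit_spec, fun α => Units.ext ?_⟩
  simp only [Units.val_mul, hu.unit_spec]
  exact (Algebra.commutes q (α : B)).symm

omit [IsQuaternionAlgebra ℚ B] hp in
/-- Membership in a translate by a central unit `ν = q · 1`: `x ∈ ν • Λ ↔ q⁻¹ • x ∈ Λ`. [cite: Voight2021, 18.4.8 (principal two-sided ideals `qO`)] -/
theorem mem_units_smul_iff_of_val_eq_algebraMap {q : ℚ} {ν : Bˣ} (hν : (ν : B) = algebraMap ℚ B q) (hq : q ≠ 0)
    {Λ : Submodule ℤ B} {x : B} : x ∈ ν • Λ ↔ q⁻¹ • x ∈ Λ := by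
  rw [mem_units_smul_submodule_iff, Units.smul_def, smul_eq_mul]
  have : ((ν⁻¹ : Bˣ) : B) = algebraMap ℚ B q⁻¹ :=
    Units.inv_eq_of_mul_eq_one_right (by rw [hν, ← map_mul, mul_inv_cancel₀ hq, map_one])
  rw [this, ← Algebra.smul_def]

/-- **The normaliser of a local maximal order at a split prime is `ℚ_pˣ GL₂(ℤ_p)`**, read on `B`: let
`Λ = Φ⁻¹(M₂(ℤ_p)) ⊆ B` for a matrix model `Φ : B → M₂(ℚ_p)` (e.g. `Λ = O₍ₚ₎` for a maximal order `O` at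
`p ∤ disc B`); if a unit `γ ∈ Bˣ` conjugates `Λ` into itself, `γ Λ γ⁻¹ ⊆ Λ`, then the one-sided ideal it
generates is two-sided and CENTRAL: **`γ Λ = p^k Λ`** for some `k ∈ ℤ` (Smith normal form
`Φ(γ) = k₁ diag(s,t) k₂`, and `‖s‖ = ‖t‖` because `diag(s,t)` must conjugate the matrix unit `E₀₁`,
approximated inside `Φ(Λ)` by density, into an integral matrix). Voight 23.2.3–23.2.8
(`N_{GL₂(ℚ_p)}(M₂(ℤ_p)) = ℚ_pˣ GL₂(ℤ_p)`), 18.4.8 (two-sided ideals of a maximal order at a split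
prime are powers of `p`). [cite: Voight2021, 23.2.8 and 18.4.8] [cite: VignerasLNM800, Ch. II §2 Thm. 2.3] -/
theorem exists_units_smul_eq_central_of_conj_le (Φ : B →ₐ[ℚ] Matrix (Fin 2) (Fin 2) ℚ_[p])
    {Λ : Submodule ℤ B} (hΛ : ∀ x, x ∈ Λ ↔ ∀ i j, ‖Φ x i j‖ ≤ 1) (γ : Bˣ)
    (hγ : ∀ x ∈ Λ, (γ : B) * x * ((γ⁻¹ : Bˣ) : B) ∈ Λ) :
    ∃ (k : ℤ) (ν : Bˣ), (ν : B) = algebraMap ℚ B ((p : ℚ) ^ k) ∧ (∀ α : Bˣ, α * ν = ν * α) ∧ γ • Λ = ν • Λ := by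
  have hpp : p.Prime := hp.out
  have hp1 : (1 : ℝ) < p := by exact_mod_cast hpp.one_lt
  -- the matrix of `γ` and its Smith normal form
  set G : Matrix (Fin 2) (Fin 2) ℚ_[p] := Φ γ with hG
  have hGinv : G * Φ ((γ⁻¹ : Bˣ) : B) = 1 := by rw [hG, ← map_mul, Units.mul_inv, map_one]
  have hGdet : G.det ≠ 0 := (Matrix.isUnit_det_of_right_inverse hGinv).ne_zero
  obtain ⟨k₁, k₂, s, t, hk₁, hk₁d, hk₂, hk₂d, hs, ht, hts, hGeq⟩ := Padic.exists_eq_mul_diagonal_mul G hGdet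
  obtain ⟨hk₁i, hk₁id⟩ := Padic.integral_inv_of_norm_det_eq_one hk₁ hk₁d
  obtain ⟨hk₂i, hk₂id⟩ := Padic.integral_inv_of_norm_det_eq_one hk₂ hk₂d
  have hk₂du : IsUnit k₂.det := isUnit_iff_ne_zero.mpr fun h => by rw [h, norm_zero] at hk₂d; exact zero_ne_one hk₂d
  have hk₁du : IsUnit k₁.det := isUnit_iff_ne_zero.mpr fun h => by rw [h, norm_zero] at hk₁d; exact zero_ne_one hk₁d
  set Δ : Matrix (Fin 2) (Fin 2) ℚ_[p] := !![s, 0; 0, t] with hΔ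
  have hΔdet : Δ.det ≠ 0 := by rw [hΔ, Matrix.det_fin_two_of]; simp [hs, ht]
  have hΔu : IsUnit Δ.det := isUnit_iff_ne_zero.mpr hΔdet
  -- Step 1: `‖s‖ ≤ ‖t‖`, by conjugating an approximation of `k₂⁻¹ E₀₁ k₂`
  have hst : ‖s‖ ≤ ‖t‖ := by
    set E : Matrix (Fin 2) (Fin 2) ℚ_[p] := Matrix.single 0 1 (1 : ℚ_[p]) with hE
    have hEint : ∀ i j, ‖E i j‖ ≤ 1 := fun i j => by
      rw [hE, Matrix.single_apply]; split_ifs <;> simp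
    set M₀ := k₂⁻¹ * E * k₂ with hM₀
    have hM₀int : ∀ i j, ‖M₀ i j‖ ≤ 1 := (Padic.forall_norm_conj_le_one_iff hk₂ hk₂d E).mpr hEint
    obtain ⟨b, hb⟩ := AlgHom.exists_norm_sub_le Φ M₀ 1
    have hbint : ∀ i j, ‖Φ b i j‖ ≤ 1 := Padic.integral_of_norm_sub_le hb hM₀int
    have hbΛ : b ∈ Λ := (hΛ b).mpr hbint
    have hcb := (hΛ _).mp (hγ b hbΛ)
    -- `Φ(γ b γ⁻¹) = G Φ(b) G⁻¹ = k₁ Δ Y Δ⁻¹ k₁⁻¹` with `Y = k₂ Φ(b) k₂⁻¹`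
    set Y := k₂ * Φ b * k₂⁻¹ with hY
    have hGi : Φ ((γ⁻¹ : Bˣ) : B) = G⁻¹ := (Matrix.inv_eq_right_inv hGinv).symm
    have hconj : Φ ((γ : B) * b * ((γ⁻¹ : Bˣ) : B)) = k₁ * (Δ * Y * Δ⁻¹) * k₁⁻¹ := by
      rw [map_mul, map_mul, hGi, ← hG, hGeq]
      rw [Matrix.mul_inv_rev, Matrix.mul_inv_rev]
      simp only [hY, Matrix.mul_assoc]
    have hDYD : ∀ i j, ‖(Δ * Y * Δ⁻¹) i j‖ ≤ 1 := by
      have h := (Padic.forall_norm_conj_le_one_iff hk₁ hk₁d (k₁ * (Δ * Y * Δ⁻¹) * k₁⁻¹)).mpr (hconj ▸ hcb)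
      have e : k₁⁻¹ * (k₁ * (Δ * Y * Δ⁻¹) * k₁⁻¹) * k₁ = Δ * Y * Δ⁻¹ := by
        rw [← Matrix.mul_assoc, ← Matrix.mul_assoc, Matrix.nonsing_inv_mul _ hk₁du, Matrix.one_mul,
          Matrix.mul_assoc, Matrix.nonsing_inv_mul _ hk₁du, Matrix.mul_one]
      rw [e] at h
      exact h
    -- the entry `(0,1)`: `‖s Y₀₁ t⁻¹‖ ≤ 1` with `‖Y₀₁‖ = 1`
    have h01 := hDYD 0 1
    rw [hΔ, Padic.diag_mul_mul_diag_inv_apply_zero_one hs ht Y] at h01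
    have hY01 : ‖Y 0 1‖ = 1 := by
      apply Padic.norm_eq_one_of_norm_sub_one_lt
      -- `Y - E' = k₂ (Φ b - M₀) k₂⁻¹` where `E' = k₂ M₀ k₂⁻¹ = E`
      have eY : Y - E = k₂ * (Φ b - M₀) * k₂⁻¹ := by
        rw [hY, hM₀, Matrix.mul_sub, Matrix.sub_mul]
        congr 1
        rw [← Matrix.mul_assoc, ← Matrix.mul_assoc, Matrix.mul_nonsing_inv _ hk₂du, Matrix.one_mul,
          Matrix.mul_assoc, Matrix.mul_nonsing_inv _ hk₂du, Matrix.mul_one]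
      have hE01 : E 0 1 = 1 := by rw [hE, Matrix.single_apply_same]
      have : Y 0 1 - 1 = (Y - E) 0 1 := by rw [Matrix.sub_apply, hE01]
      rw [this, eY]
      have hle := Padic.norm_mul_mul_apply_le hk₂ hb hk₂i zero_le_one (by positivity) 0 1
      refine hle.trans_lt ?_
      rw [one_mul, mul_one]
      exact zpow_lt_one_of_neg₀ hp1 (by norm_num)
    rw [norm_mul, norm_mul, hY01, mul_one, norm_inv] at h01
    have htpos : 0 < ‖t‖ := norm_pos_iff.mpr ht
    rwa [mul_inv_le_iff₀ htpos, one_mul] at h01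
  have hst' : ‖s‖ = ‖t‖ := le_antisymm hst hts
  -- Step 2: `G = p^k W` with `W ∈ GL₂(ℤ_p)`
  set k : ℤ := s.valuation with hk
  have hsn : ‖s‖ = (p : ℝ) ^ (-k) := Padic.norm_eq_zpow_neg_valuation hs
  set c : ℚ_[p] := (p : ℚ_[p]) ^ k with hc
  have hc0 : c ≠ 0 := zpow_ne_zero _ (by exact_mod_cast hpp.ne_zero)
  have hcn : ‖c‖ = (p : ℝ) ^ (-k) := by rw [hc, Padic.norm_p_zpow]
  have hcs : ‖c‖ = ‖s‖ := by rw [hcn, hsn]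
  have hcpos : 0 < ‖c‖ := norm_pos_iff.mpr hc0
  -- `W = c⁻¹ G ∈ GL₂(ℤ_p)`
  set W : Matrix (Fin 2) (Fin 2) ℚ_[p] := k₁ * !![s / c, 0; 0, t / c] * k₂ with hW
  have hspos : 0 < ‖s‖ := norm_pos_iff.mpr hs
  have hDint : ∀ i j, ‖(!![s / c, 0; 0, t / c] : Matrix (Fin 2) (Fin 2) ℚ_[p]) i j‖ ≤ 1 := by
    intro i j
    fin_cases i <;> fin_cases j
    · show ‖s / c‖ ≤ 1
      rw [norm_div, hcs, div_self hspos.ne']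
    · show ‖(0 : ℚ_[p])‖ ≤ 1
      simp
    · show ‖(0 : ℚ_[p])‖ ≤ 1
      simp
    · show ‖t / c‖ ≤ 1
      rw [norm_div, hcs, hst', div_self (norm_pos_iff.mpr ht).ne']
  have hDdet : ‖(!![s / c, 0; 0, t / c] : Matrix (Fin 2) (Fin 2) ℚ_[p]).det‖ = 1 := by
    rw [Matrix.det_fin_two_of, mul_zero, sub_zero, norm_mul, norm_div, norm_div, hcs, ← hst',
      div_self hspos.ne', mul_one]
  obtain ⟨hW₁, hW₁d⟩ := Padic.integral_mul_of_norm_det_eq_one hk₁ hk₁d hDint hDdet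
  obtain ⟨hWint, hWdet⟩ := Padic.integral_mul_of_norm_det_eq_one hW₁ hW₁d hk₂ hk₂d
  have hWu : IsUnit W.det := isUnit_iff_ne_zero.mpr fun h => by rw [h, norm_zero] at hWdet; exact zero_ne_one hWdet
  have hGcW : G = c • W := by
    have e : c • (!![s / c, 0; 0, t / c] : Matrix (Fin 2) (Fin 2) ℚ_[p]) = !![s, 0; 0, t] := by
      ext i j
      fin_cases i <;> fin_cases j
      · show c • (s / c) = s
        rw [smul_eq_mul, mul_div_cancel₀ _ hc0]
      · show c • (0 : ℚ_[p]) = 0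
        rw [smul_zero]
      · show c • (0 : ℚ_[p]) = 0
        rw [smul_zero]
      · show c • (t / c) = t
        rw [smul_eq_mul, mul_div_cancel₀ _ hc0]
    rw [hGeq, hW, hΔ, ← e, Matrix.mul_smul, Matrix.smul_mul]
  have hGi : G⁻¹ = c⁻¹ • W⁻¹ := by
    refine Matrix.inv_eq_left_inv ?_
    rw [hGcW, Matrix.smul_mul, Matrix.mul_smul, smul_smul, inv_mul_cancel₀ hc0, one_smul,
      Matrix.nonsing_inv_mul _ hWu]
  have hΦγi : Φ ((γ⁻¹ : Bˣ) : B) = G⁻¹ := (Matrix.inv_eq_right_inv hGinv).symm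
  -- the central unit `ν = p^k`
  have hq0 : ((p : ℚ) ^ k) ≠ 0 := zpow_ne_zero _ (by exact_mod_cast hpp.ne_zero)
  obtain ⟨ν, hν, hνc⟩ := exists_units_val_eq_algebraMap (B := B) hq0
  refine ⟨k, ν, hν, hνc, ?_⟩
  have hcq : algebraMap ℚ ℚ_[p] (((p : ℚ) ^ k)⁻¹) = c⁻¹ := by
    rw [map_inv₀, map_zpow₀, map_natCast]
  ext x
  rw [mem_units_smul_submodule_iff, mem_units_smul_iff_of_val_eq_algebraMap hν hq0, hΛ, hΛ,
    Units.smul_def, smul_eq_mul, map_mul, hΦγi, hGi, map_smul, ← algebraMap_smul ℚ_[p] (((p : ℚ) ^ k)⁻¹) (Φ x), hcq,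
    Matrix.smul_mul, ← Matrix.mul_smul]
  exact Padic.forall_norm_inv_mul_le_one_iff hWint hWdet _

end SplitNormaliser

/-! ## §2 One-sided ideals generated by a unit at a ramified prime: `γ O₍ₚ₎ = p^a O₍ₚ₎` or `p^a P₍ₚ₎` -/

section Ramified

variable {B : Type u} [Ring B] [Algebra ℚ B] [IsQuaternionAlgebra ℚ B] {O : Submodule ℤ B} {p : ℕ} [hp : Fact p.Prime]

omit [Algebra ℚ B] [IsQuaternionAlgebra ℚ B] hp in
/-- For a multiplicatively closed lattice `Λ ∋ 1` (e.g. a local order) and units `α, β`: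
`α Λ = β Λ ⟺ α⁻¹β ∈ Λ ∧ β⁻¹α ∈ Λ`. [cite: Voight2021, 16.2 (principal ideals) and Lemma 17.3.3] -/
theorem units_smul_eq_units_smul_iff {Λ : Submodule ℤ B} (h1 : (1 : B) ∈ Λ)
    (hmul : ∀ a ∈ Λ, ∀ b ∈ Λ, a * b ∈ Λ) (α β : Bˣ) :
    α • Λ = β • Λ ↔ ((α⁻¹ : Bˣ) : B) * β ∈ Λ ∧ ((β⁻¹ : Bˣ) : B) * α ∈ Λ := by
  have key : ∀ α β : Bˣ, ((β⁻¹ : Bˣ) : B) * α ∈ Λ → α • Λ ≤ β • Λ := by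
    intro α β h x hx
    rw [mem_units_smul_submodule_iff, Units.smul_def, smul_eq_mul] at hx ⊢
    have : ((β⁻¹ : Bˣ) : B) * x = ((β⁻¹ : Bˣ) : B) * α * (((α⁻¹ : Bˣ) : B) * x) := by
      simp [mul_assoc]
    rw [this]
    exact hmul _ h _ hx
  constructor
  · intro h
    constructor
    · have hβ : (β : B) ∈ α • Λ := by
        rw [h, mem_units_smul_submodule_iff, Units.smul_def, smul_eq_mul, Units.inv_mul]; exact h1
      rwa [mem_units_smul_submodule_iff, Units.smul_def, smul_eq_mul] at hβ
    · have hα : (α : B) ∈ β • Λ := by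
        rw [← h, mem_units_smul_submodule_iff, Units.smul_def, smul_eq_mul, Units.inv_mul]; exact h1
      rwa [mem_units_smul_submodule_iff, Units.smul_def, smul_eq_mul] at hα
  · rintro ⟨hαβ, hβα⟩
    exact le_antisymm (key α β hβα) (key β α hαβ)

/-- The reduced norm of a unit is non-zero. [folklore] -/
private theorem reducedNorm_units_ne_zero'' (u : Bˣ) : reducedNorm ℚ B (u : B) ≠ 0 :=
  (isUnit_iff_reducedNorm_ne_zero_holds ℚ B (u : B)).mp u.isUnit

variable (hOp : ∀ x : B, x ∈ localAt p O ↔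
  ¬ p ∣ (reducedNorm ℚ B x).den ∧ ¬ p ∣ (reducedTrace ℚ B x).den)
variable (hnt : ∀ x : B, ¬ p ∣ (reducedNorm ℚ B x).den → ¬ p ∣ (reducedTrace ℚ B x).den)
include hOp hnt

omit [IsQuaternionAlgebra ℚ B] in
/-- **At a ramified prime the local maximal order is a valuation ring read through `nrd`**:
`x ∈ O₍ₚ₎ ⟺ v_p(nrd x) ≥ 0` (Vignéras II §1 Lemme 1.4: the valuation ring `{h : n(h) ∈ R}`; a private copy of the tree's
`mem_localAt_iff_padicValRat_of_ramified`, which is stated for the norm-only form of the hypothesis). [cite: VignerasLNM800, Ch. II §1 Lemme 1.4] -/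
private theorem mem_localAt_iff_padicValRat_nonneg (x : B) : x ∈ localAt p O ↔ 0 ≤ padicValRat p (reducedNorm ℚ B x) := by
  rw [hOp, ← not_dvd_den_iff_padicValRat_nonneg]
  exact ⟨fun h => h.1, fun h => ⟨h, hnt x h⟩⟩

variable (hdivp : ∀ X : ScalarExtension ℚ ℚ_[p] B, X ≠ 0 → IsUnit X)
include hdivp

omit hnt in
/-- A uniformiser has `v_p(nrd u) = 1`. [cite: VignerasLNM800, Ch. II §1 Lemme 1.5] -/
theorem padicValRat_reducedNorm_uniformiser (hO : IsZOrder O) {u : Bˣ} (hu : (u : B) ∈ normPrimeIdeal O p)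
    (hup : (u : B) ∉ (p : ℤ) • O) : padicValRat p (reducedNorm ℚ B (u : B)) = 1 := by
  obtain ⟨n, hn, hpn⟩ := exists_reducedNorm_uniformiser hdivp hOp hO hu hup
  have hn0 : n ≠ 0 := by rintro rfl; exact hpn (dvd_zero _)
  rw [hn, padicValRat.mul (by exact_mod_cast hp.out.ne_zero) (by exact_mod_cast hn0), padicValRat.self hp.out.one_lt,
    padicValRat.of_int, padicValInt.eq_zero_of_not_dvd hpn]
  simp

/-- **One-sided local ideals at a ramified prime**: for every unit `γ ∈ Bˣ`, the right `O₍ₚ₎`-module `γ O₍ₚ₎` is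
`p^a O₍ₚ₎` or `p^a P₍ₚ₎ = p^a u O₍ₚ₎` (`a ∈ ℤ`, `u` a uniformiser, `P` the prime of `O` above `p`), according to
the parity of `v_p(nrd γ)` — all ideals of the valuation ring of the local division algebra are the two-sided
powers `P^m = u^m O_p` (Vignéras II §1 Lemme 1.5: «les idéaux … sont bilatères, et sont les puissances de P»;
Voight Thm. 13.3.11). [cite: VignerasLNM800, Ch. II §1 Lemme 1.5] [cite: Voight2021, Thm. 13.3.11] -/
theorem exists_units_smul_localAt_eq_central_of_ramified (hO : IsZOrder O) (γ : Bˣ) :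
    ∃ (a : ℤ) (ν : Bˣ), (ν : B) = algebraMap ℚ B ((p : ℚ) ^ a) ∧ (∀ α : Bˣ, α * ν = ν * α) ∧
      (γ • localAt p O = ν • localAt p O ∨ γ • localAt p O = ν • localAt p (normPrimeIdeal O p)) := by
  have hpp := hp.out
  have hdiv : ∀ x : B, x ≠ 0 → IsUnit x := forall_isUnit_of_padic_division hdivp
  have h1 : (1 : B) ∈ localAt p O := le_localAt p O hO.one_mem
  have hmul : ∀ a ∈ localAt p O, ∀ b ∈ localAt p O, a * b ∈ localAt p O :=
    fun a ha b hb => mul_mem_localAt hO.mul_mem p ha hb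
  obtain ⟨u, hu, hup⟩ := exists_uniformiser (O := O) hdivp hO
  have hvu := padicValRat_reducedNorm_uniformiser hOp hdivp hO hu hup
  set v : ℤ := padicValRat p (reducedNorm ℚ B (γ : B)) with hv
  set a : ℤ := v / 2 with ha
  set ε : ℤ := v % 2 with hε
  have hvε : v = 2 * a + ε := by omega
  have hq0 : ((p : ℚ) ^ a) ≠ 0 := zpow_ne_zero _ (by exact_mod_cast hpp.ne_zero)
  obtain ⟨ν, hν, hνc⟩ := exists_units_val_eq_algebraMap (B := B) hq0
  have hvν : padicValRat p (reducedNorm ℚ B (ν : B)) = 2 * a := by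
    rw [hν, reducedNorm_algebraMap, ← zpow_natCast, ← zpow_mul, padicValRat.zpow, padicValRat.self hpp.one_lt]
    push_cast; ring
  have hvγi : padicValRat p (reducedNorm ℚ B ((γ⁻¹ : Bˣ) : B)) = -v := by
    rw [reducedNorm_units_inv, padicValRat.inv]
  refine ⟨a, ν, hν, hνc, ?_⟩
  -- the valuation criterion for `δ` and `δ⁻¹`
  have crit : ∀ δ : Bˣ, padicValRat p (reducedNorm ℚ B (δ : B)) = 0 →
      (δ : B) ∈ localAt p O ∧ ((δ⁻¹ : Bˣ) : B) ∈ localAt p O := by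
    intro δ hδ
    refine ⟨(mem_localAt_iff_padicValRat_nonneg hOp hnt _).mpr hδ.ge,
      (mem_localAt_iff_padicValRat_nonneg hOp hnt _).mpr ?_⟩
    rw [reducedNorm_units_inv, padicValRat.inv, hδ, neg_zero]
  rcases Int.emod_two_eq v with h0 | h1'
  · -- even valuation: `γ O₍ₚ₎ = p^a O₍ₚ₎`
    left
    have hε0 : ε = 0 := by rw [hε, h0]
    rw [units_smul_eq_units_smul_iff h1 hmul]
    have hval : padicValRat p (reducedNorm ℚ B ((γ⁻¹ * ν : Bˣ) : B)) = 0 := by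
      rw [Units.val_mul, reducedNorm_mul_holds ℚ B, padicValRat.mul (reducedNorm_units_ne_zero'' _) (reducedNorm_units_ne_zero'' _),
        hvγi, hvν, hvε, hε0]; ring
    obtain ⟨hδ, hδi⟩ := crit _ hval
    rw [mul_inv_rev, inv_inv] at hδi
    exact ⟨by simpa using hδ, by simpa using hδi⟩
  · -- odd valuation: `γ O₍ₚ₎ = p^a u O₍ₚ₎ = p^a P₍ₚ₎`
    right
    have hε1 : ε = 1 := by rw [hε, h1']
    rw [localAt_normPrimeIdeal_eq_units_smul hdivp hOp hO hu hup, ← mul_smul, units_smul_eq_units_smul_iff h1 hmul]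
    have hval : padicValRat p (reducedNorm ℚ B ((γ⁻¹ * (ν * u) : Bˣ) : B)) = 0 := by
      rw [Units.val_mul, Units.val_mul, reducedNorm_mul_holds ℚ B, reducedNorm_mul_holds ℚ B,
        padicValRat.mul (reducedNorm_units_ne_zero'' _) (mul_ne_zero (reducedNorm_units_ne_zero'' _) (reducedNorm_units_ne_zero'' _)),
        padicValRat.mul (reducedNorm_units_ne_zero'' _) (reducedNorm_units_ne_zero'' _), hvγi, hvν, hvu, hvε, hε1]; ring
    obtain ⟨hδ, hδi⟩ := crit _ hval
    rw [mul_inv_rev, inv_inv] at hδi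
    exact ⟨by simpa [mul_assoc] using hδ, by simpa [mul_assoc] using hδi⟩

end Ramified

/-! ## §3 Left orders of the right ideals of a maximal order are maximal -/

section LeftOrderMaximal

namespace Brandt

variable {D : Type u} [Ring D] [IsAddTorsionFree D]

/-- **The left order of an invertible right ideal of a maximal order is maximal** (Voight 17.4.3 / Lemma 17.4.11: orders
connected by an invertible ideal; here: if `O_R(I) = O` is maximal, `I I⁻¹ = O_L(I)`, `I⁻¹ I = O`, and `O'' ⊇ O_L(I)` is an order,
then `I⁻¹ O'' I` is an order containing `O`, so equals `O`, whence `O'' ⊆ O_L(I) O'' O_L(I) = I (I⁻¹ O'' I) I⁻¹ = I O I⁻¹ = O_L(I)`).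
[cite: Voight2021, Lemma 17.4.11 and 17.4.3] [cite: VignerasLNM800, Ch. I §4 Lemme 4.10] -/
theorem IsMaximalOrder.isMaximalOrder_leftOrder {O : Submodule ℤ D} (hO : IsMaximalOrder D O) {I : Submodule ℤ D}
    (hI : I ∈ rightIdeals O) : IsMaximalOrder D (leftOrder I) := by
  obtain ⟨hIfull, hIO, Iinv, hinvfull, h1, h2, h3, h4⟩ := hI
  rw [hIO] at h3
  refine ⟨isOrder_leftOrder hIfull, fun O'' hO'' hle => ?_⟩
  set L : Submodule ℤ D := Iinv * (O'' * I) with hLdef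
  have hII : I * O = I := by rw [← hIO]; exact mul_rightOrder_self I
  -- `O ≤ L`
  have hOL : O ≤ L := by
    rw [← h3, hLdef]
    calc Iinv * I = Iinv * (leftOrder I * I) := by rw [leftOrder_mul_self]
      _ ≤ Iinv * (O'' * I) := mul_le_mul' le_rfl (mul_le_mul' hle le_rfl)
  -- `L` is an order
  have hLL : L * L ≤ L := by
    have e : L * L = Iinv * ((O'' * leftOrder I * O'') * I) := by
      rw [hLdef, ← h1]; simp only [mul_assoc]
    rw [e, hLdef]
    refine mul_le_mul' le_rfl (mul_le_mul' ?_ le_rfl)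
    calc O'' * leftOrder I * O'' ≤ O'' * O'' * O'' := mul_le_mul' (mul_le_mul' le_rfl hle) le_rfl
      _ = O'' := by rw [hO''.mul_self, hO''.mul_self]
  have hLord : IsOrder D L :=
    { one_mem := hOL hO.1.one_mem
      mul_mem := fun a ha b hb => hLL (Submodule.mul_mem_mul ha hb)
      isFullLattice := ⟨hinvfull.1.mul (hO''.isFullLattice.1.mul hIfull.1), fun d => by
        obtain ⟨n, hn, hnd⟩ := hO.1.isFullLattice.2 d
        exact ⟨n, hn, hOL hnd⟩⟩ }
  have hL : L = O := hO.2 L hLord hOL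
  -- `O_L(I) O'' O_L(I) = O_L(I)`
  have key : leftOrder I * O'' * leftOrder I = leftOrder I := by
    calc leftOrder I * O'' * leftOrder I = (I * Iinv) * O'' * (I * Iinv) := by rw [h1]
      _ = I * (Iinv * (O'' * I)) * Iinv := by simp only [mul_assoc]
      _ = I * O * Iinv := by rw [← hLdef, hL]
      _ = leftOrder I := by rw [hII, h1]
  refine le_antisymm (fun x hx => ?_) hle
  rw [← key]
  have : x = 1 * x * 1 := by rw [one_mul, mul_one]
  rw [this]
  exact Submodule.mul_mem_mul (Submodule.mul_mem_mul (one_mem_leftOrder I) hx) (one_mem_leftOrder I)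

end Brandt

/-- The same in the `BrandtModule` vocabulary: for a maximal `ℤ`-order `O` of a quaternion algebra over `ℚ` and an invertible right
`O`-ideal `I`, the left order `O_ℓ(I)` is a maximal `ℤ`-order. [cite: Voight2021, Lemma 17.4.11 and 17.4.3] -/
theorem IsInvertibleRightIdeal.isMaximalZOrder_leftOrderOf {B : Type u} [Ring B] [Algebra ℚ B] [IsQuaternionAlgebra ℚ B]
    (hdiv : ∀ x : B, x ≠ 0 → IsUnit x) {O I : Submodule ℤ B} (hO : IsMaximalZOrder O) (hI : IsInvertibleRightIdeal O I) :
    IsMaximalZOrder (leftOrderOf I) := by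
  haveI : IsAddTorsionFree B := isAddTorsionFree_of_charZero_module ℚ B
  haveI : Nontrivial B := Module.nontrivial_of_finrank_pos (R := ℚ)
    (by rw [IsQuaternionAlgebra.finrank_eq_four (K := ℚ) (D := B)]; norm_num)
  have h := mem_rightIdeals_of_isInvertibleRightIdeal hdiv hO.1 hI
  rw [isMaximalZOrder_iff_isMaximalOrder] at hO ⊢
  rw [leftOrderOf_eq_leftOrder]
  exact hO.isMaximalOrder_leftOrder h

end LeftOrderMaximal

/-! ## §4 Maximal orders of the definite quaternion algebra of prime discriminant `p` -/

section PrimeDiscriminant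

/-- An Eichler order of level `1` is a maximal order (`[O₁ : O] = 1` forces `O = O₁`). [cite: Voight2021, Def. 23.4.1] -/
theorem IsEichlerOrder.isMaximalZOrder_of_one {B : Type u} [Ring B]
    {O : Submodule ℤ B} (h : IsEichlerOrder O 1) : IsMaximalZOrder O := by
  obtain ⟨O₁, O₂, h₁, -, hO, hidx⟩ := h
  have hle : O₁ ≤ O := by
    have := AddSubgroup.relIndex_eq_one.mp hidx
    exact fun x hx => this hx
  have : O = O₁ := le_antisymm (hO ▸ inf_le_left) hle
  rwa [this]

namespace Brandt

open Literature.NumberTheory.Automorphic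

variable {p : ℕ} [hp : Fact p.Prime]

/-- The order of a setup of type `(1, N⁻)` is a maximal `ℤ`-order. [cite: Voight2021, Def. 23.4.1] -/
theorem XiSetup.isMaximalZOrder {Nminus : ℕ} (S : XiSetup 1 Nminus) : IsMaximalZOrder S.O :=
  (isEichlerOrder_iff_brandt.mpr S.isEichlerOrder).isMaximalZOrder_of_one

/-- The order of a setup is a `ℤ`-order. [cite: Voight2021, Def. 10.2.1 and Def. 23.4.1] -/
theorem XiSetup.isZOrder_O {Nplus Nminus : ℕ} (S : XiSetup Nplus Nminus) : IsZOrder S.O :=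
  (isEichlerOrder_iff_brandt.mpr S.isEichlerOrder).isZOrder

/-- Right ideals of a setup are invertible right ideals (BrandtModule vocabulary). [cite: Voight2021, Def. 16.5.1 and Main Thm. 16.6.1] -/
theorem XiSetup.isInvertibleRightIdeal_of_mem {Nplus Nminus : ℕ} (S : XiSetup Nplus Nminus) {I : Submodule ℤ S.D}
    (hI : I ∈ rightIdeals S.O) : IsInvertibleRightIdeal S.O I := by
  rw [rightIdeals_eq_invertibleRightIdeals_of_isTotallyDefinite S.isTotallyDefinite S.isZOrder_O] at hI
  exact hI

/-- Invertible right ideals of a setup are right ideals (BrandtXi vocabulary). [cite: Voight2021, Def. 16.5.1 and Main Thm. 16.6.1] -/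
theorem XiSetup.mem_rightIdeals_of_isInvertibleRightIdeal {Nplus Nminus : ℕ} (S : XiSetup Nplus Nminus)
    {I : Submodule ℤ S.D} (hI : IsInvertibleRightIdeal S.O I) : I ∈ rightIdeals S.O := by
  rw [rightIdeals_eq_invertibleRightIdeals_of_isTotallyDefinite S.isTotallyDefinite S.isZOrder_O]
  exact hI

/-- The ramification hypothesis of a setup in the `EichlerPackage` form. [cite: PollackWeston2011, §2.1] -/
theorem XiSetup.mem_ramifiedPlaces_iff' {Nplus Nminus : ℕ} (S : XiSetup Nplus Nminus)
    (v : IsDedekindDomain.HeightOneSpectrum (NumberField.RingOfIntegers ℚ)) :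
    v ∈ ramifiedPlaces ℚ S.D ↔ ((Nminus : ℕ) : NumberField.RingOfIntegers ℚ) ∈ v.asIdeal := by
  rw [S.ramifiedPlaces_eq, Set.mem_setOf_eq, primesEquiv_dvd_iff]

variable (S : XiSetup 1 p)

/-- `ℚ_p ⊗ D` is a division algebra for a setup of type `(1, p)` (`ScalarExtension` form). [cite: VignerasLNM800, Ch. III §3] -/
theorem XiSetup.hdivp : ∀ X : ScalarExtension ℚ ℚ_[p] S.D, X ≠ 0 → IsUnit X :=
  S.toEichlerPackage.forall_isUnit_scalarExtension_padic (dvd_refl p)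

/-- `O₍ₚ₎ = {x : nrd x, trd x ∈ ℤ₍ₚ₎}` for a setup of type `(1, p)`. [cite: VignerasLNM800, Ch. II §1 Lemme 1.5] -/
theorem XiSetup.hOp : ∀ x : S.D, x ∈ localAt p S.O ↔
    ¬ p ∣ (reducedNorm ℚ S.D x).den ∧ ¬ p ∣ (reducedTrace ℚ S.D x).den :=
  S.toEichlerPackage.maximalAtP (dvd_refl p)

/-- The algebra of a setup is a division algebra. [folklore] -/
private theorem XiSetup.hdiv' {Nplus Nminus : ℕ} (S : XiSetup Nplus Nminus) : ∀ x : S.D, x ≠ 0 → IsUnit x :=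
  fun _ hx => isUnit_of_isTotallyDefinite S.D S.isTotallyDefinite hx

/-- `nrd x ∈ ℤ₍ₚ₎ ⟹ trd x ∈ ℤ₍ₚ₎` in the algebra of a setup of type `(1, p)`. [cite: VignerasLNM800, Ch. II §1 Lemme 1.4] -/
theorem XiSetup.hnt : ∀ x : S.D, ¬ p ∣ (reducedNorm ℚ S.D x).den → ¬ p ∣ (reducedTrace ℚ S.D x).den :=
  fun x hx => not_dvd_den_reducedTrace_of_reducedNorm S.hdiv'
    (isUnit_padicTensor_of_dvd S.D S.mem_ramifiedPlaces_iff' (dvd_refl p)) x hx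

/-- **`O_L(I P) = O_L(I)`** for every right ideal `I` of the maximal order `O` (`P` the prime above `p`): `O_L(I) ⊆ O_L(IP) ⊆
O_L(IPP) = O_L(pI) = O_L(I)`. [cite: Voight2021, 18.4.8 and Lemma 17.4.11] -/
theorem XiSetup.leftOrder_mul_normPrimeIdeal {I : Submodule ℤ S.D} (hI : I ∈ rightIdeals S.O) :
    leftOrder (I * normPrimeIdeal S.O p) = leftOrder I := by
  have hIinv := S.isInvertibleRightIdeal_of_mem hI
  have hIP := isInvertibleRightIdeal_mul_normPrimeIdeal S.hdivp S.hOp S.isZOrder_O hIinv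
  have h2 : I * normPrimeIdeal S.O p * normPrimeIdeal S.O p = (p : ℤ) • I :=
    mul_normPrimeIdeal_mul_normPrimeIdeal S.hdivp S.hOp S.isZOrder_O hIinv
  -- `O_L(p I) = O_L(I)`
  obtain ⟨ν, hν, hνc⟩ := exists_units_val_eq_natCast (D := S.D) hp.out.ne_zero
  have hpI : (p : ℤ) • I = ν • I := by
    ext x
    constructor
    · intro hx
      obtain ⟨y, hy, rfl⟩ := (Submodule.mem_smul_pointwise_iff_exists x _ I).mp hx
      exact units_smul_eq_zsmul_of_val_eq hν I hy
    · intro hx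
      obtain ⟨y, hy, rfl⟩ := exists_eq_zsmul_of_mem_units_smul hν hx
      exact Submodule.smul_mem_pointwise_smul y _ I hy
  have h3 : leftOrder ((p : ℤ) • I) = leftOrder I := by
    rw [hpI, ← leftOrderOf_eq_leftOrder, leftOrderOf_units_smul, leftOrderOf_eq_leftOrder]
    ext x
    rw [mem_units_smul_submodule_iff, mem_op_units_smul_submodule_iff, inv_inv, Units.smul_def, smul_eq_mul]
    have hc : x * (ν : S.D) = ν * x := by rw [hν]; exact ((Int.cast_commute (p : ℤ) x).eq).symm
    have : ((ν⁻¹ : S.Dˣ) : S.D) * x * ν = x := by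
      rw [mul_assoc, hc, Units.inv_mul_cancel_left]
    rw [this]
  refine le_antisymm ?_ (leftOrder_le_leftOrder_mul I _)
  calc leftOrder (I * normPrimeIdeal S.O p) ≤ leftOrder (I * normPrimeIdeal S.O p * normPrimeIdeal S.O p) :=
        leftOrder_le_leftOrder_mul _ _
    _ = leftOrder I := by rw [h2, h3]

/-- Rational scalars: `(ℓ : ℤ) • ((ℓ : ℚ)⁻¹ • x) = x`. [folklore] -/
private theorem natCast_zsmul_inv_smul {V : Type*} [AddCommGroup V] [Module ℚ V] {ℓ : ℕ} (hℓ : ℓ ≠ 0) (x : V) :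
    (ℓ : ℤ) • ((ℓ : ℚ)⁻¹ • x) = x := by
  rw [← Int.cast_smul_eq_zsmul ℚ, smul_smul, Int.cast_natCast, mul_inv_cancel₀ (by exact_mod_cast hℓ), one_smul]

/-- **The central case of the peeling step**: if `I' ⊆ I` and `I'₍ℓ₎ ⊆ ℓ^k I₍ℓ₎` with `k ≥ 1`, then `I' ⊆ ℓ I`
(local–global principle for membership). [cite: Voight2021, Lemma 9.4.6] -/
theorem XiSetup.le_natCast_smul_of_localAt_le {Nplus Nminus : ℕ} (S : XiSetup Nplus Nminus) {I I' : Submodule ℤ S.D}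
    (hle : I' ≤ I) {ℓ : ℕ} (hℓ : ℓ.Prime) {k : ℤ} (hk : 1 ≤ k) {ν : S.Dˣ}
    (hν : (ν : S.D) = algebraMap ℚ S.D ((ℓ : ℚ) ^ k)) (hloc : localAt ℓ I' ≤ ν • localAt ℓ I) :
    I' ≤ (ℓ : ℤ) • I := by
  intro x hx
  have hℓ0 : (ℓ : ℚ) ≠ 0 := by exact_mod_cast hℓ.ne_zero
  have hq0 : ((ℓ : ℚ) ^ k) ≠ 0 := zpow_ne_zero _ hℓ0
  set y : S.D := (ℓ : ℚ)⁻¹ • x with hy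
  have hxy : x = (ℓ : ℤ) • y := (natCast_zsmul_inv_smul hℓ.ne_zero x).symm
  suffices hyI : y ∈ I by rw [hxy]; exact Submodule.smul_mem_pointwise_smul y (ℓ : ℤ) I hyI
  refine mem_of_forall_prime_mem_localAt fun q hq => ?_
  by_cases hqℓ : q = ℓ
  · subst hqℓ
    have hx' : ((q : ℚ) ^ k)⁻¹ • x ∈ localAt q I :=
      (mem_units_smul_iff_of_val_eq_algebraMap hν hq0).mp (hloc (le_localAt q I' hx))
    have e : y = (((q ^ (k - 1).toNat : ℕ) : ℤ)) • (((q : ℚ) ^ k)⁻¹ • x) := by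
      rw [← Int.cast_smul_eq_zsmul ℚ, smul_smul, hy]
      congr 1
      push_cast
      rw [← zpow_natCast, Int.toNat_of_nonneg (by omega), ← zpow_neg, ← zpow_add₀ hℓ0, ← zpow_neg_one]
      congr 1; ring
    rw [e]
    exact Submodule.smul_mem _ _ hx'
  · refine mem_localAt_of_smul_mem hℓ.ne_zero ((Nat.coprime_primes hℓ hq).mpr (Ne.symm hqℓ)) ?_
    rw [← hxy]; exact hle hx

/-- A central unit `ν = q · 1 ∈ O₍ℓ₎` (`O` a `ℤ`-order) has `v_ℓ(q²) ≥ 0`: a rational scalar in a local order is `ℓ`-integral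
up to its square. [folklore] -/
private theorem padicValRat_sq_nonneg_of_mem_localAt {Nplus Nminus : ℕ} (S : XiSetup Nplus Nminus) {ℓ : ℕ} [Fact ℓ.Prime]
    {q : ℚ} {ν : S.Dˣ} (hν : (ν : S.D) = algebraMap ℚ S.D q) (hmem : (ν : S.D) ∈ localAt ℓ S.O) :
    0 ≤ padicValRat ℓ (q ^ 2) := by
  have h := (S.isZOrder_O.not_dvd_den_of_mem_localAt hmem).1
  rw [hν, reducedNorm_algebraMap] at h
  exact not_dvd_den_iff_padicValRat_nonneg.mp h

/-- Translation by a unit is monotone on lattices. [folklore] -/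
private theorem units_smul_mono {B : Type u} [Ring B] (β : Bˣ) {I J : Submodule ℤ B} (h : I ≤ J) : β • I ≤ β • J := by
  intro x hx
  rw [mem_units_smul_submodule_iff] at hx ⊢
  exact h hx

/-- **The peeling step.** For right ideals `I' ⊊ I` of the maximal order `O` (discriminant `p`) with the same left order, either
`I' ⊆ ℓ I` for some prime `ℓ`, or `I' ⊆ I P` (`P` the prime of `O` above `p`): at a prime `ℓ` where `I'₍ℓ₎ ≠ I₍ℓ₎` write
`I₍ℓ₎ = α O₍ℓ₎`, `I'₍ℓ₎ = α' O₍ℓ₎`; then `γ = α⁻¹α'` conjugates `O₍ℓ₎` into itself, so `γ O₍ℓ₎ = ℓ^k O₍ℓ₎` (`ℓ ≠ p`, §1) or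
`γ O₍ₚ₎ ∈ {p^a O₍ₚ₎, p^a P₍ₚ₎}` (§2). [cite: Voight2021, Prop. 18.5.10 and 18.4.8] [cite: VignerasLNM800, Ch. I §4 Lemme 4.10] -/
theorem XiSetup.exists_le_smul_or_le_mul_of_leftOrder_eq {I I' : Submodule ℤ S.D} (hI : I ∈ rightIdeals S.O)
    (hI' : I' ∈ rightIdeals S.O) (hL : leftOrder I = leftOrder I') (hle : I' ≤ I) (hne : I' ≠ I) :
    (∃ ℓ : ℕ, ℓ.Prime ∧ I' ≤ (ℓ : ℤ) • I) ∨ I' ≤ I * normPrimeIdeal S.O p := by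
  have hpp := hp.out
  have hO := S.isZOrder_O
  have hIi := S.isInvertibleRightIdeal_of_mem hI
  have hI'i := S.isInvertibleRightIdeal_of_mem hI'
  -- a prime where the localisations differ
  obtain ⟨ℓ, hℓ, hneℓ⟩ : ∃ ℓ : ℕ, ℓ.Prime ∧ localAt ℓ I' ≠ localAt ℓ I := by
    by_contra h
    push Not at h
    exact hne (eq_iff_forall_prime_localAt_eq.mpr h)
  haveI : Fact ℓ.Prime := ⟨hℓ⟩
  obtain ⟨α, hα, hαL⟩ := IsInvertibleRightIdeal.exists_localAt_leftOrderOf S.hdiv' hO hIi ℓ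
  obtain ⟨α', hα', hα'L⟩ := IsInvertibleRightIdeal.exists_localAt_leftOrderOf S.hdiv' hO hI'i ℓ
  set Λ := localAt ℓ S.O with hΛdef
  have h1 : (1 : S.D) ∈ Λ := le_localAt ℓ S.O hO.one_mem
  have hmul : ∀ a ∈ Λ, ∀ b ∈ Λ, a * b ∈ Λ := fun a ha b hb => mul_mem_localAt hO.mul_mem ℓ ha hb
  have hLL : α • (MulOpposite.op ((α⁻¹ : S.Dˣ) : S.D) • Λ) = α' • (MulOpposite.op ((α'⁻¹ : S.Dˣ) : S.D) • Λ) := by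
    rw [← hαL, ← hα'L, leftOrderOf_eq_leftOrder, leftOrderOf_eq_leftOrder, hL]
  set γ : S.Dˣ := α⁻¹ * α' with hγdef
  -- `γ` conjugates `Λ` into itself
  have hγ : ∀ x ∈ Λ, (γ : S.D) * x * ((γ⁻¹ : S.Dˣ) : S.D) ∈ Λ := by
    intro x hx
    have hx' : (α' : S.D) * x * ((α'⁻¹ : S.Dˣ) : S.D) ∈ α' • (MulOpposite.op ((α'⁻¹ : S.Dˣ) : S.D) • Λ) := by
      rw [mem_units_smul_submodule_iff, mem_op_units_smul_submodule_iff, inv_inv, Units.smul_def, smul_eq_mul]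
      simpa [mul_assoc] using hx
    rw [← hLL, mem_units_smul_submodule_iff, mem_op_units_smul_submodule_iff, inv_inv, Units.smul_def, smul_eq_mul] at hx'
    rw [hγdef, mul_inv_rev, inv_inv, Units.val_mul, Units.val_mul]
    simpa [mul_assoc] using hx'
  -- and `γ Λ ⊆ Λ`
  have hγle : γ • Λ ≤ Λ := by
    intro x hx
    rw [mem_units_smul_submodule_iff, hγdef, mul_inv_rev, inv_inv, Units.smul_def, Units.val_mul, smul_eq_mul,
      mul_assoc] at hx
    have h2 : (α : S.D) * x ∈ α' • Λ := by
      rw [mem_units_smul_submodule_iff, Units.smul_def, smul_eq_mul]; exact hx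
    rw [← hα'] at h2
    have h3 := (localAt_mono ℓ hle) h2
    rw [hα, mem_units_smul_submodule_iff, Units.smul_def, smul_eq_mul, Units.inv_mul_cancel_left] at h3
    exact h3
  -- `I'₍ℓ₎ = α γ Λ`
  have hI'loc : localAt ℓ I' = α • (γ • Λ) := by
    rw [hα', hγdef, ← mul_smul, mul_inv_cancel_left]
  by_cases hℓp : ℓ = p
  · -- the ramified prime
    subst hℓp
    obtain ⟨a, ν, hν, hνc, hcase⟩ :=
      exists_units_smul_localAt_eq_central_of_ramified S.hOp S.hnt S.hdivp hO γ
    have hq0 : ((ℓ : ℚ) ^ a) ≠ 0 := zpow_ne_zero _ (by exact_mod_cast hpp.ne_zero)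
    rcases hcase with hA | hB
    · -- `γ Λ = p^a Λ`, `a ≥ 1`
      left
      rw [← hΛdef] at hA
      refine ⟨ℓ, hpp, ?_⟩
      have hνmem : (ν : S.D) ∈ Λ := by
        apply hγle; rw [hA, mem_units_smul_submodule_iff, Units.smul_def, smul_eq_mul, Units.inv_mul]; exact h1
      have ha0 : 0 ≤ a := by
        have h := padicValRat_sq_nonneg_of_mem_localAt S hν hνmem
        rw [← zpow_natCast, ← zpow_mul, padicValRat.zpow, padicValRat.self hpp.one_lt] at h
        simp only [Nat.cast_ofNat, mul_one] at h
        omega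
      have ha1 : 1 ≤ a := by
        by_contra hlt
        have hν1 : ν = 1 := Units.ext (by rw [hν, show a = 0 by omega, zpow_zero, map_one, Units.val_one])
        apply hneℓ
        rw [hI'loc, hA, hν1, one_smul, hα]
      refine S.le_natCast_smul_of_localAt_le hle hpp ha1 hν ?_
      rw [hI'loc, hA, hα, ← mul_smul, hνc, mul_smul]
    · -- `γ Λ = p^a P₍ₚ₎ = p^a u Λ`
      obtain ⟨u, hu, hup⟩ := exists_uniformiser (O := S.O) S.hdivp hO
      have hPu : localAt ℓ (normPrimeIdeal S.O ℓ) = u • Λ := localAt_normPrimeIdeal_eq_units_smul S.hdivp S.hOp hO hu hup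
      have huΛ : (u : S.D) ∈ Λ := le_localAt ℓ S.O (normPrimeIdeal_le S.O ℓ hu)
      rw [hPu, ← hΛdef] at hB
      have hνu : (ν : S.D) * u ∈ Λ := by
        apply hγle
        rw [hB, ← mul_smul, mem_units_smul_submodule_iff, Units.smul_def, smul_eq_mul, ← Units.val_mul, Units.inv_mul]
        exact h1
      have ha0 : 0 ≤ a := by
        have h := (hO.not_dvd_den_of_mem_localAt hνu).1
        rw [not_dvd_den_iff_padicValRat_nonneg, reducedNorm_mul_holds ℚ S.D,
          padicValRat.mul (reducedNorm_units_ne_zero'' _) (reducedNorm_units_ne_zero'' _),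
          padicValRat_reducedNorm_uniformiser S.hOp S.hdivp hO hu hup, hν, reducedNorm_algebraMap, ← zpow_natCast,
          ← zpow_mul, padicValRat.zpow, padicValRat.self hpp.one_lt] at h
        simp only [Nat.cast_ofNat, mul_one] at h
        omega
      rcases eq_or_lt_of_le ha0 with ha | ha
      · -- `a = 0`: `I'₍ₚ₎ = (I P)₍ₚ₎`, so `I' ⊆ I P`
        right
        have hν1 : (ν : S.D) = 1 := by rw [hν, ← ha, zpow_zero, map_one]
        have hν1' : ν = 1 := Units.ext hν1
        rw [hν1', one_smul] at hB
        have hIP : localAt ℓ (I * normPrimeIdeal S.O ℓ) = (α * u) • Λ :=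
          localAt_mul_normPrimeIdeal_self S.hdivp S.hOp hO hα hu hup
        intro y hy
        refine mem_of_forall_prime_mem_localAt fun q hq => ?_
        by_cases hqℓ : q = ℓ
        · subst hqℓ
          rw [hIP, mul_smul, ← hB, ← hI'loc]
          exact le_localAt q I' hy
        · rw [localAt_mul_normPrimeIdeal_of_ne hO hIi hq hqℓ]
          exact le_localAt q I (hle hy)
      · -- `a ≥ 1`: `I' ⊆ p I`
        left
        refine ⟨ℓ, hpp, S.le_natCast_smul_of_localAt_le hle hpp (by omega) hν ?_⟩
        rw [hI'loc, hB, hα, ← mul_smul α ν, hνc α, mul_smul]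
        refine units_smul_mono ν (units_smul_mono α fun x hx => ?_)
        rw [mem_units_smul_submodule_iff, Units.smul_def, smul_eq_mul] at hx
        have := hmul _ huΛ _ hx
        rwa [Units.mul_inv_cancel_left] at this
  · -- a split prime
    left
    refine ⟨ℓ, hℓ, ?_⟩
    have hℓN : ¬ ℓ ∣ p := fun h => hℓp ((Nat.prime_dvd_prime_iff_eq hℓ hpp).mp h)
    obtain ⟨φ⟩ := exists_algHom_matrix_of_not_dvd (p := ℓ) S.mem_ramifiedPlaces_iff' hℓN
    obtain ⟨w, hw⟩ := S.isMaximalZOrder.exists_conjUnit_localAt_iff S.hdiv' φ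
    obtain ⟨k, ν, hν, hνc, hγν⟩ := exists_units_smul_eq_central_of_conj_le (AlgHom.conjUnit φ w) hw γ hγ
    rw [← hΛdef] at hγν
    have hνmem : (ν : S.D) ∈ Λ := by
      apply hγle; rw [hγν, mem_units_smul_submodule_iff, Units.smul_def, smul_eq_mul, Units.inv_mul]; exact h1
    have hk0 : 0 ≤ k := by
      have h := padicValRat_sq_nonneg_of_mem_localAt S hν hνmem
      rw [← zpow_natCast, ← zpow_mul, padicValRat.zpow, padicValRat.self hℓ.one_lt] at h
      simp only [Nat.cast_ofNat, mul_one] at h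
      omega
    have hk1 : 1 ≤ k := by
      by_contra hlt
      have hν1 : ν = 1 := Units.ext (by rw [hν, show k = 0 by omega, zpow_zero, map_one, Units.val_one])
      apply hneℓ
      rw [hI'loc, hγν, hν1, one_smul, hα]
    refine S.le_natCast_smul_of_localAt_le hle hℓ hk1 hν ?_
    rw [hI'loc, hγν, hα, ← mul_smul, hνc, mul_smul]

/-- `m M ⊆ L` for a finitely generated `M` and a full lattice `L`. [folklore] -/
private theorem exists_natCast_smul_mem {D : Type u} [AddCommGroup D] {M L : Submodule ℤ D} (hM : M.FG)
    (hL : ∀ d : D, ∃ n : ℤ, n ≠ 0 ∧ n • d ∈ L) : ∃ m : ℕ, m ≠ 0 ∧ ∀ x ∈ M, (m : ℤ) • x ∈ L := by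
  classical
  obtain ⟨s, hs⟩ := hM
  have hgen : ∀ x ∈ s, ∃ m : ℤ, m ≠ 0 ∧ m • x ∈ L := fun x _ => hL x
  choose! m hm0 hm using hgen
  refine ⟨(∏ x ∈ s, m x).natAbs, Int.natAbs_ne_zero.mpr (Finset.prod_ne_zero_iff.mpr hm0), ?_⟩
  intro x hx
  rw [← hs] at hx
  suffices hx' : (∏ x ∈ s, m x) • x ∈ L by
    rcases Int.natAbs_eq (∏ x ∈ s, m x) with h | h
    · rwa [← h]
    · rw [show ((∏ x ∈ s, m x).natAbs : ℤ) = -(∏ x ∈ s, m x) by omega, neg_smul]; exact L.neg_mem hx'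
  refine Submodule.span_induction (p := fun y _ => (∏ x ∈ s, m x) • y ∈ L) ?_ (by simp)
    (fun a b _ _ ha hb => by rw [smul_add]; exact L.add_mem ha hb)
    (fun c a _ ha => by rw [smul_comm]; exact L.smul_mem c ha) hx
  intro y hy
  rw [← Finset.prod_erase_mul _ _ hy, mul_smul]
  exact L.smul_mem _ (hm y hy)

/-- A central unit `ν = n · 1` acts as the integer `n`: `ν J = n J`. [folklore] -/
private theorem units_smul_eq_natCast_smul {D : Type u} [Ring D] {ν : Dˣ} {n : ℕ} (hν : (ν : D) = (n : ℤ))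
    (J : Submodule ℤ D) : ν • J = (n : ℤ) • J := by
  ext x
  constructor
  · intro hx
    obtain ⟨y, hy, rfl⟩ := exists_eq_zsmul_of_mem_units_smul hν hx
    exact Submodule.smul_mem_pointwise_smul y _ J hy
  · intro hx
    obtain ⟨y, hy, rfl⟩ := (Submodule.mem_smul_pointwise_iff_exists x _ J).mp hx
    exact units_smul_eq_zsmul_of_val_eq hν J hy

/-- Left orders are unchanged by a central (rational integer) rescaling: `O_L(n I) = O_L(I)`. [cite: Voight2021, 17.4.3] -/
private theorem leftOrder_units_smul_of_val_eq_natCast {D : Type u} [Ring D] {ν : Dˣ} {n : ℕ} (hν : (ν : D) = (n : ℤ))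
    (J : Submodule ℤ D) : leftOrder (ν • J) = leftOrder J := by
  rw [← leftOrderOf_eq_leftOrder, leftOrderOf_units_smul, leftOrderOf_eq_leftOrder]
  ext x
  rw [mem_units_smul_submodule_iff, mem_op_units_smul_submodule_iff, inv_inv, Units.smul_def, smul_eq_mul]
  have hc : x * (ν : D) = ν * x := by rw [hν]; exact ((Int.cast_commute (n : ℤ) x).eq).symm
  rw [mul_assoc, hc, Units.inv_mul_cancel_left]

/-- **Right ideals with the same left order, nested case.** If `I' ⊆ I` are right ideals of the maximal order `O` of the definite
quaternion algebra of prime discriminant `p` with `O_L(I) = O_L(I')`, then `I' = c I` or `I' = c I P` for a positive integer `c`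
(`P` the prime of `O` above `p`) — the two-sided `O_L(I)`-ideal `I' I⁻¹` is a rational multiple of `O_L(I)` or of its prime above
`p` (Voight 18.4.8: `Pic O ≅ ℤ/2` generated by the prime above `p`; Prop. 18.5.10). [cite: Voight2021, Prop. 18.5.10 and 18.4.8] -/
theorem XiSetup.exists_eq_smul_of_leftOrder_eq_of_le {I I' : Submodule ℤ S.D} (hI : I ∈ rightIdeals S.O)
    (hI' : I' ∈ rightIdeals S.O) (hL : leftOrder I = leftOrder I') (hle : I' ≤ I) :
    ∃ c : ℕ, c ≠ 0 ∧ (I' = (c : ℤ) • I ∨ I' = (c : ℤ) • (I * normPrimeIdeal S.O p)) := by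
  have hpp := hp.out
  have hO := S.isZOrder_O
  haveI : IsAddTorsionFree S.D := S.isAddTorsionFree
  suffices key : ∀ (d : ℕ) {I I' : Submodule ℤ S.D}, I ∈ rightIdeals S.O → I' ∈ rightIdeals S.O →
      leftOrder I = leftOrder I' → I' ≤ I → I'.toAddSubgroup.relIndex I.toAddSubgroup = d →
      ∃ c : ℕ, c ≠ 0 ∧ (I' = (c : ℤ) • I ∨ I' = (c : ℤ) • (I * normPrimeIdeal S.O p)) from
    key _ hI hI' hL hle rfl
  intro d
  induction d using Nat.strong_induction_on with
  | _ d ih =>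
  intro I I' hI hI' hL hle hd
  have hIi := S.isInvertibleRightIdeal_of_mem hI
  -- the index is finite
  have hd0 : d ≠ 0 := by
    obtain ⟨m, hm0, hm⟩ := exists_natCast_smul_mem hI.1.1 hI'.1.2
    rw [← hd]
    exact relIndex_ne_zero_of_smul_mem I hI.1.1 (by exact_mod_cast hm0 : (m : ℤ) ≠ 0) I' hm
  by_cases heq : I' = I
  · exact ⟨1, one_ne_zero, Or.inl (by rw [heq, Nat.cast_one, one_smul])⟩
  rcases S.exists_le_smul_or_le_mul_of_leftOrder_eq hI hI' hL hle heq with ⟨ℓ, hℓ, hI'ℓ⟩ | hI'P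
  · -- `I' ⊆ ℓ I`: divide by `ℓ`
    obtain ⟨ν, hν, hνc⟩ := exists_units_val_eq_natCast (D := S.D) hℓ.ne_zero
    set I'' : Submodule ℤ S.D := ν⁻¹ • I' with hI''def
    have hI''mem : I'' ∈ rightIdeals S.O :=
      S.mem_rightIdeals_of_isInvertibleRightIdeal (IsInvertibleRightIdeal.units_smul ν⁻¹ (S.isInvertibleRightIdeal_of_mem hI'))
    have hνI'' : I' = ν • I'' := by rw [hI''def, smul_inv_smul]
    have hI'eq : I' = (ℓ : ℤ) • I'' := by rw [hνI'', units_smul_eq_natCast_smul hν]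
    have hI''le : I'' ≤ I := by
      intro x hx
      rw [hI''def, mem_units_smul_submodule_iff, inv_inv] at hx
      have h1 : (ℓ : ℤ) • x ∈ (ℓ : ℤ) • I := by
        have : ν • x = (ℓ : ℤ) • x := by rw [Units.smul_def, smul_eq_mul, hν, zsmul_eq_mul]
        rw [← this]; exact hI'ℓ hx
      obtain ⟨y, hy, hxy⟩ := (Submodule.mem_smul_pointwise_iff_exists _ _ I).mp h1
      have hℓ0 : ((ℓ : ℤ) : ℚ) ≠ 0 := by exact_mod_cast hℓ.ne_zero
      have : x = y := by
        apply smul_right_injective S.D hℓ0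
        show ((ℓ : ℤ) : ℚ) • x = ((ℓ : ℤ) : ℚ) • y
        rw [Int.cast_smul_eq_zsmul, Int.cast_smul_eq_zsmul]; exact hxy.symm
      rw [this]; exact hy
    have hLI'' : leftOrder I'' = leftOrder I' := by
      rw [hνI'', leftOrder_units_smul_of_val_eq_natCast hν]
    -- the index drops by `ℓ⁴`
    have hI'le'' : I' ≤ I'' := by
      rw [hI'eq]; intro x hx
      obtain ⟨y, hy, rfl⟩ := (Submodule.mem_smul_pointwise_iff_exists x _ I'').mp hx
      exact I''.smul_mem _ hy
    have hidx : I'.toAddSubgroup.relIndex I''.toAddSubgroup = ℓ ^ 4 := by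
      rw [hI'eq]; exact relIndex_natCast_smul_eq_pow_four hI''mem.1 hℓ.ne_zero
    have hmul := AddSubgroup.relIndex_mul_relIndex (H := I'.toAddSubgroup) (K := I''.toAddSubgroup) (L := I.toAddSubgroup)
      hI'le'' hI''le
    rw [hidx, hd] at hmul
    have hlt : I''.toAddSubgroup.relIndex I.toAddSubgroup < d := by
      have h4 : 1 < ℓ ^ 4 := Nat.one_lt_pow (by norm_num) hℓ.one_lt
      have hpos : 0 < I''.toAddSubgroup.relIndex I.toAddSubgroup := by
        rcases Nat.eq_zero_or_pos (I''.toAddSubgroup.relIndex I.toAddSubgroup) with h | h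
        · rw [h, mul_zero] at hmul; exact absurd hmul.symm hd0
        · exact h
      nlinarith
    obtain ⟨c, hc, hcase⟩ := ih _ hlt hI hI''mem (hL.trans hLI''.symm) hI''le rfl
    refine ⟨ℓ * c, mul_ne_zero hℓ.ne_zero hc, ?_⟩
    rcases hcase with h | h
    · left; rw [hI'eq, h, smul_smul]; norm_cast
    · right; rw [hI'eq, h, smul_smul]; norm_cast
  · -- `I' ⊆ I P`
    set J : Submodule ℤ S.D := I * normPrimeIdeal S.O p with hJdef
    have hJi : IsInvertibleRightIdeal S.O J := isInvertibleRightIdeal_mul_normPrimeIdeal S.hdivp S.hOp hO hIi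
    have hJ : J ∈ rightIdeals S.O := S.mem_rightIdeals_of_isInvertibleRightIdeal hJi
    have hLJ : leftOrder J = leftOrder I := S.leftOrder_mul_normPrimeIdeal hI
    have hJle : J ≤ I := mul_normPrimeIdeal_le hIi
    have hJidx : J.toAddSubgroup.relIndex I.toAddSubgroup = p ^ 2 := relIndex_mul_normPrimeIdeal S.hdivp S.hOp hO hIi
    have hmul := AddSubgroup.relIndex_mul_relIndex (H := I'.toAddSubgroup) (K := J.toAddSubgroup) (L := I.toAddSubgroup)
      hI'P hJle
    rw [hJidx, hd] at hmul
    have hlt : I'.toAddSubgroup.relIndex J.toAddSubgroup < d := by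
      have h4 : 1 < p ^ 2 := Nat.one_lt_pow (by norm_num) hpp.one_lt
      have hpos : 0 < I'.toAddSubgroup.relIndex J.toAddSubgroup := by
        rcases Nat.eq_zero_or_pos (I'.toAddSubgroup.relIndex J.toAddSubgroup) with h | h
        · rw [h, zero_mul] at hmul; exact absurd hmul.symm hd0
        · exact h
      nlinarith
    obtain ⟨c, hc, hcase⟩ := ih _ hlt hJ hI' (hLJ.trans hL) hI'P rfl
    rcases hcase with h | h
    · exact ⟨c, hc, Or.inr h⟩
    · refine ⟨c * p, mul_ne_zero hc hpp.ne_zero, Or.inl ?_⟩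
      rw [h, hJdef, mul_normPrimeIdeal_mul_normPrimeIdeal S.hdivp S.hOp hO hIi, smul_smul]; norm_cast

/-- **Right ideals with the same left order** (maximal orders of the definite quaternion algebra of prime discriminant `p`): if
`O_L(I) = O_L(I')` then `m I' = c I` or `m I' = c I P` for positive integers `m, c` — the fibre of `I ↦ O_L(I)` above `O_L(I)`
consists of the rational multiples of `I` and of `I P` (Voight Prop. 18.5.10 with `[Idl(O') : ℚ^× ] = 2`, 18.4.8).
[cite: Voight2021, Prop. 18.5.10 and 18.4.8] [cite: VignerasLNM800, Ch. I §4 Lemme 4.10] -/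
theorem XiSetup.exists_smul_eq_smul_of_leftOrder_eq {I I' : Submodule ℤ S.D} (hI : I ∈ rightIdeals S.O)
    (hI' : I' ∈ rightIdeals S.O) (hL : leftOrder I = leftOrder I') :
    ∃ m c : ℕ, m ≠ 0 ∧ c ≠ 0 ∧
      ((m : ℤ) • I' = (c : ℤ) • I ∨ (m : ℤ) • I' = (c : ℤ) • (I * normPrimeIdeal S.O p)) := by
  obtain ⟨m, hm0, hm⟩ := exists_natCast_smul_mem hI'.1.1 hI.1.2
  obtain ⟨ν, hν, hνc⟩ := exists_units_val_eq_natCast (D := S.D) hm0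
  have hmI' : (m : ℤ) • I' = ν • I' := (units_smul_eq_natCast_smul hν I').symm
  have hmem : (m : ℤ) • I' ∈ rightIdeals S.O := by
    rw [hmI']; exact S.mem_rightIdeals_of_isInvertibleRightIdeal (IsInvertibleRightIdeal.units_smul ν (S.isInvertibleRightIdeal_of_mem hI'))
  have hle : (m : ℤ) • I' ≤ I := by
    intro x hx
    obtain ⟨y, hy, rfl⟩ := (Submodule.mem_smul_pointwise_iff_exists x _ I').mp hx
    exact hm y hy
  have hL' : leftOrder I = leftOrder ((m : ℤ) • I') := by rw [hmI', leftOrder_units_smul_of_val_eq_natCast hν, hL]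
  obtain ⟨c, hc, h⟩ := S.exists_eq_smul_of_leftOrder_eq_of_le hI hmem hL' hle
  exact ⟨m, c, hm0, hc, h⟩

/-! ### The involution `c ↦ [I_c P]` on `Cls O` and the fibres of `[I] ↦ O_L(I)` -/

/-- `(β J) T = β (J T)` for lattices. [folklore] -/
private theorem units_smul_mul' {D : Type u} [Ring D] (β : Dˣ) (J T : Submodule ℤ D) : (β • J) * T = β • (J * T) :=
  smul_mul_assoc β J T

/-- `I_c P` is a right ideal of `O`. [cite: VignerasLNM800, Ch. II §1 Cor. 1.7] -/
theorem XiSetup.rep_mul_normPrimeIdeal_mem (c : ClassSet S.O) : c.rep * normPrimeIdeal S.O p ∈ rightIdeals S.O :=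
  S.mem_rightIdeals_of_isInvertibleRightIdeal
    (isInvertibleRightIdeal_mul_normPrimeIdeal S.hdivp S.hOp S.isZOrder_O (S.isInvertibleRightIdeal_of_mem c.rep_mem))

/-- `I P` is a right ideal of `O` for every right ideal `I`. [cite: VignerasLNM800, Ch. II §1 Cor. 1.7] -/
theorem XiSetup.mul_normPrimeIdeal_mem {I : Submodule ℤ S.D} (hI : I ∈ rightIdeals S.O) :
    I * normPrimeIdeal S.O p ∈ rightIdeals S.O :=
  S.mem_rightIdeals_of_isInvertibleRightIdeal
    (isInvertibleRightIdeal_mul_normPrimeIdeal S.hdivp S.hOp S.isZOrder_O (S.isInvertibleRightIdeal_of_mem hI))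

omit hp in
/-- Equal lattices have equal classes (transport of the membership proof). [folklore] -/
private theorem mk_congr {O : Submodule ℤ S.D} {I J : Submodule ℤ S.D} (hI : I ∈ rightIdeals O) (hJ : J ∈ rightIdeals O)
    (h : I = J) : (Quotient.mk (rightClassSetoid O) ⟨I, hI⟩ : ClassSet O) = Quotient.mk (rightClassSetoid O) ⟨J, hJ⟩ := by
  subst h; rfl

omit hp in
/-- Classes of translates: `[α I] = [I]`. [folklore] -/
private theorem mk_units_smul_eq {O : Submodule ℤ S.D} (α : S.Dˣ) {I : Submodule ℤ S.D} (hI : I ∈ rightIdeals O)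
    (hαI : α • I ∈ rightIdeals O) :
    (Quotient.mk (rightClassSetoid O) ⟨α • I, hαI⟩ : ClassSet O) = Quotient.mk (rightClassSetoid O) ⟨I, hI⟩ :=
  Quotient.sound ⟨α⁻¹, by simp [inv_smul_smul]⟩

omit hp in
/-- Classes of integer multiples: `[n I] = [I]`. [folklore] -/
private theorem mk_natCast_smul_eq {O : Submodule ℤ S.D} {n : ℕ} (hn : n ≠ 0) {I : Submodule ℤ S.D} (hI : I ∈ rightIdeals O)
    (hnI : (n : ℤ) • I ∈ rightIdeals O) :
    (Quotient.mk (rightClassSetoid O) ⟨(n : ℤ) • I, hnI⟩ : ClassSet O) = Quotient.mk (rightClassSetoid O) ⟨I, hI⟩ := by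
  obtain ⟨ν, hν, -⟩ := exists_units_val_eq_natCast (D := S.D) hn
  have h : (n : ℤ) • I = ν • I := (units_smul_eq_natCast_smul hν I).symm
  rw [mk_congr S hnI (h ▸ hnI) h, mk_units_smul_eq S ν hI]

/-- **The class `[I P]` only depends on the class `[I]`**: `[(αI) P] = [I P]`. [cite: VignerasLNM800, Ch. III §5 exercice 5.8 (b)] -/
theorem XiSetup.mk_smul_mul_normPrimeIdeal (α : S.Dˣ) {I : Submodule ℤ S.D} (hI : I ∈ rightIdeals S.O)
    (hαI : α • I ∈ rightIdeals S.O) :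
    (Quotient.mk (rightClassSetoid S.O) ⟨α • I * normPrimeIdeal S.O p, S.mul_normPrimeIdeal_mem hαI⟩ : ClassSet S.O) =
      Quotient.mk (rightClassSetoid S.O) ⟨I * normPrimeIdeal S.O p, S.mul_normPrimeIdeal_mem hI⟩ := by
  have h : α • I * normPrimeIdeal S.O p = α • (I * normPrimeIdeal S.O p) := units_smul_mul' α I _
  have hmem : α • (I * normPrimeIdeal S.O p) ∈ rightIdeals S.O := h ▸ S.mul_normPrimeIdeal_mem hαI
  rw [mk_congr S _ hmem h, mk_units_smul_eq S α (S.mul_normPrimeIdeal_mem hI)]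

/-- **`[I P]` only depends on `[I]`**, class form: `[I] = [J] ⟹ [I P] = [J P]`. [cite: VignerasLNM800, Ch. III §5 exercice 5.8 (b)] -/
theorem XiSetup.mk_mul_normPrimeIdeal_congr {I J : Submodule ℤ S.D} (hI : I ∈ rightIdeals S.O) (hJ : J ∈ rightIdeals S.O)
    (h : (Quotient.mk (rightClassSetoid S.O) ⟨I, hI⟩ : ClassSet S.O) = Quotient.mk (rightClassSetoid S.O) ⟨J, hJ⟩) :
    (Quotient.mk (rightClassSetoid S.O) ⟨I * normPrimeIdeal S.O p, S.mul_normPrimeIdeal_mem hI⟩ : ClassSet S.O) =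
      Quotient.mk (rightClassSetoid S.O) ⟨J * normPrimeIdeal S.O p, S.mul_normPrimeIdeal_mem hJ⟩ := by
  obtain ⟨α, hα⟩ := Quotient.exact h
  -- `J = α I`
  have hα' : J = α • I := hα
  have hαI : α • I ∈ rightIdeals S.O := hα' ▸ hJ
  rw [mk_congr S (S.mul_normPrimeIdeal_mem hJ) (S.mul_normPrimeIdeal_mem hαI) (by rw [hα']),
    S.mk_smul_mul_normPrimeIdeal α hI hαI]

/-- **`[I_{[I]} P] = [I P]`**: the class `[I_c P]` may be computed on any representative of `c`. [cite: VignerasLNM800, Ch. III §5 exercice 5.8 (b)] -/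
theorem XiSetup.mk_rep_mk_mul_normPrimeIdeal (I : rightIdeals S.O) :
    (Quotient.mk (rightClassSetoid S.O) ⟨ClassSet.rep (Quotient.mk (rightClassSetoid S.O) I : ClassSet S.O) * normPrimeIdeal S.O p,
        S.rep_mul_normPrimeIdeal_mem _⟩ : ClassSet S.O) =
      Quotient.mk (rightClassSetoid S.O) ⟨(I : Submodule ℤ S.D) * normPrimeIdeal S.O p, S.mul_normPrimeIdeal_mem I.2⟩ :=
  S.mk_mul_normPrimeIdeal_congr (ClassSet.rep_mem _) I.2 (by rw [ClassSet.mk_rep])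

/-- **`c ↦ [I_c P]` is an involution on `Cls O`**: `[I_{[I_c P]} P] = [I_c P P] = [p I_c] = c` (`P² = pO`; the Atkin–Lehner
involution `W_p` of the Brandt module at the ramified prime). [cite: VignerasLNM800, Ch. II §1 Cor. 1.7 and Ch. III §5 exercice 5.8 (c)] -/
theorem XiSetup.mk_rep_mul_normPrimeIdeal_mul_normPrimeIdeal (c : ClassSet S.O) :
    (Quotient.mk (rightClassSetoid S.O)
        ⟨ClassSet.rep (Quotient.mk (rightClassSetoid S.O) ⟨c.rep * normPrimeIdeal S.O p, S.rep_mul_normPrimeIdeal_mem c⟩ :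
            ClassSet S.O) * normPrimeIdeal S.O p, S.rep_mul_normPrimeIdeal_mem _⟩ : ClassSet S.O) = c := by
  rw [S.mk_rep_mk_mul_normPrimeIdeal ⟨c.rep * normPrimeIdeal S.O p, S.rep_mul_normPrimeIdeal_mem c⟩]
  have h2 : c.rep * normPrimeIdeal S.O p * normPrimeIdeal S.O p = (p : ℤ) • c.rep :=
    mul_normPrimeIdeal_mul_normPrimeIdeal S.hdivp S.hOp S.isZOrder_O (S.isInvertibleRightIdeal_of_mem c.rep_mem)
  have hmem : (p : ℤ) • c.rep ∈ rightIdeals S.O := h2 ▸ S.mul_normPrimeIdeal_mem (S.rep_mul_normPrimeIdeal_mem c)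
  have e := mk_congr S (S.mul_normPrimeIdeal_mem (S.rep_mul_normPrimeIdeal_mem c)) hmem h2
  refine (e.trans ?_)
  rw [mk_natCast_smul_eq S hp.out.ne_zero c.rep_mem hmem, ClassSet.mk_rep]

/-- `O_L(I_{[I_c P]})` is conjugate to `O_L(I_c)`: the involution `c ↦ [I_c P]` preserves the type. [cite: Voight2021, Remark 17.4.15 and Prop. 18.5.10] -/
theorem XiSetup.exists_leftOrder_rep_mk_mul_normPrimeIdeal_eq_conj (c : ClassSet S.O) :
    ∃ β : S.Dˣ, leftOrder (ClassSet.rep (Quotient.mk (rightClassSetoid S.O)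
        ⟨c.rep * normPrimeIdeal S.O p, S.rep_mul_normPrimeIdeal_mem c⟩ : ClassSet S.O)) =
      β • (MulOpposite.op ((β⁻¹ : S.Dˣ) : S.D) • leftOrder c.rep) := by
  obtain ⟨β, hβ⟩ := exists_rep_mk_eq_smul (O := S.O) ⟨c.rep * normPrimeIdeal S.O p, S.rep_mul_normPrimeIdeal_mem c⟩
  refine ⟨β, ?_⟩
  rw [hβ]
  change leftOrderOf (β • (c.rep * normPrimeIdeal S.O p)) = _
  rw [leftOrderOf_units_smul]
  change β • (MulOpposite.op ((β⁻¹ : S.Dˣ) : S.D) • leftOrder (c.rep * normPrimeIdeal S.O p)) = _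
  rw [S.leftOrder_mul_normPrimeIdeal c.rep_mem]

/-- **THE FIBRES OF `[I] ↦ O_L(I)` (Voight Prop. 18.5.10 at prime discriminant): if the left orders `O_L(I_c)`, `O_L(I_{c'})` of two
classes are conjugate, then `c' = c` or `c' = [I_c P]`** — every fibre of `Cls O → Typ O` is an orbit `{c, [I_c P]}` of the
Atkin–Lehner involution (of size `1` or `2 = [Idl(O_L(I_c)) : ℚ^× O_L(I_c)-principal]`). [cite: Voight2021, Prop. 18.5.10 and 18.4.8] [cite: VignerasLNM800, Ch. I §4 Lemme 4.10] -/
theorem XiSetup.eq_or_eq_mk_mul_normPrimeIdeal_of_leftOrder_conj {c c' : ClassSet S.O} {β : S.Dˣ}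
    (h : leftOrder c'.rep = β • (MulOpposite.op ((β⁻¹ : S.Dˣ) : S.D) • leftOrder c.rep)) :
    c' = c ∨ c' = Quotient.mk (rightClassSetoid S.O) ⟨c.rep * normPrimeIdeal S.O p, S.rep_mul_normPrimeIdeal_mem c⟩ := by
  -- `I := β I_c` has `O_L(I) = O_L(I_{c'})`
  have hI : β • c.rep ∈ rightIdeals S.O :=
    S.mem_rightIdeals_of_isInvertibleRightIdeal (IsInvertibleRightIdeal.units_smul β (S.isInvertibleRightIdeal_of_mem c.rep_mem))
  have hL : leftOrder (β • c.rep) = leftOrder c'.rep := by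
    rw [h]
    exact leftOrderOf_units_smul β c.rep
  obtain ⟨m, k, hm, hk, hcase⟩ := S.exists_smul_eq_smul_of_leftOrder_eq hI c'.rep_mem hL
  have hmI' : (m : ℤ) • c'.rep ∈ rightIdeals S.O := by
    obtain ⟨ν, hν, -⟩ := exists_units_val_eq_natCast (D := S.D) hm
    rw [← units_smul_eq_natCast_smul hν]
    exact S.mem_rightIdeals_of_isInvertibleRightIdeal (IsInvertibleRightIdeal.units_smul ν (S.isInvertibleRightIdeal_of_mem c'.rep_mem))
  have hc' : c' = Quotient.mk (rightClassSetoid S.O) ⟨(m : ℤ) • c'.rep, hmI'⟩ := by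
    rw [mk_natCast_smul_eq S hm c'.rep_mem hmI', ClassSet.mk_rep]
  rcases hcase with h1 | h2
  · left
    have hkI : (k : ℤ) • (β • c.rep) ∈ rightIdeals S.O := h1 ▸ hmI'
    rw [hc', mk_congr S hmI' hkI h1, mk_natCast_smul_eq S hk hI hkI, mk_units_smul_eq S β c.rep_mem hI, ClassSet.mk_rep]
  · right
    have hkI : (k : ℤ) • (β • c.rep * normPrimeIdeal S.O p) ∈ rightIdeals S.O := h2 ▸ hmI'
    rw [hc', mk_congr S hmI' hkI h2, mk_natCast_smul_eq S hk (S.mul_normPrimeIdeal_mem hI) hkI,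
      S.mk_smul_mul_normPrimeIdeal β c.rep_mem hI]

/-! ### The Brandt matrix `T(p)` permutes the classes by `c ↦ [I_c P]` -/

open Classical in
/-- **The Brandt matrix at the ramified prime is the permutation matrix of `c ↦ [I_c P]`**: `T(p)_{c c'} = 1` if
`c = [I_{c'} P]`, else `0` (the unique right ideal of index `p²` in `I_{c'}` is `I_{c'} P`; BrandtXi's `Brandt.matrix`, transported from
`BrandtData.ofOrder_T_ramified_apply` / `subidealCount_ramified_eq_one`). [cite: VignerasLNM800, Ch. III §5 exercice 5.8 (b)] -/
theorem XiSetup.matrix_ramified_apply (c c' : ClassSet S.O) :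
    matrix S.O p c c' =
      if c = Quotient.mk (rightClassSetoid S.O) ⟨c'.rep * normPrimeIdeal S.O p, S.rep_mul_normPrimeIdeal_mem c'⟩ then 1 else 0 := by
  have hO := S.isZOrder_O
  have h : rightIdeals S.O = invertibleRightIdeals S.O :=
    rightIdeals_eq_invertibleRightIdeals_of_isTotallyDefinite S.isTotallyDefinite hO
  have hIi : IsInvertibleRightIdeal S.O c'.rep := S.isInvertibleRightIdeal_of_mem c'.rep_mem
  -- `e c = [I_c]`, `e c' = [I_{c'}]` on the `RightIdealClass` side
  have he : ClassSet.equivRightIdealClass h c = RightIdealClass.mk ⟨c.rep, h ▸ c.rep_mem⟩ := by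
    have := ClassSet.equivRightIdealClass_mk h ⟨c.rep, c.rep_mem⟩
    rwa [ClassSet.mk_rep] at this
  have he' : ClassSet.equivRightIdealClass h c' = RightIdealClass.mk ⟨c'.rep, h ▸ c'.rep_mem⟩ := by
    have := ClassSet.equivRightIdealClass_mk h ⟨c'.rep, c'.rep_mem⟩
    rwa [ClassSet.mk_rep] at this
  have hT := BrandtData.ofOrder_T_equivRightIdealClass hO h p c' c
  rw [← hT, he, he', BrandtData.ofOrder_T_mk hO ⟨c'.rep, h ▸ c'.rep_mem⟩]
  -- the condition, transported
  have key : c = Quotient.mk (rightClassSetoid S.O) ⟨c'.rep * normPrimeIdeal S.O p, S.rep_mul_normPrimeIdeal_mem c'⟩ ↔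
      RightIdealClass.mk ⟨c'.rep * normPrimeIdeal S.O p, isInvertibleRightIdeal_mul_normPrimeIdeal S.hdivp S.hOp hO hIi⟩ =
        RightIdealClass.mk ⟨c.rep, h ▸ c.rep_mem⟩ := by
    rw [← (ClassSet.equivRightIdealClass h).apply_eq_iff_eq, he, ClassSet.equivRightIdealClass_mk, eq_comm]
  by_cases hc : c = Quotient.mk (rightClassSetoid S.O) ⟨c'.rep * normPrimeIdeal S.O p, S.rep_mul_normPrimeIdeal_mem c'⟩
  · rw [if_pos hc]
    have := subidealCount_ramified_eq_one S.hdivp S.hOp hO hIi (key.mp hc)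
    change ((subidealCount S.O c'.rep p _ : ℕ) : ℤ) = 1
    rw [this, Nat.cast_one]
  · rw [if_neg hc]
    have := subidealCount_ramified_eq_zero S.hdivp S.hOp hO hIi (fun e => hc (key.mpr e))
    change ((subidealCount S.O c'.rep p _ : ℕ) : ℤ) = 0
    rw [this, Nat.cast_zero]

open Classical in
/-- **The diagonal of `T(p)`**: `T(p)_{cc} = 1` if the involution fixes `c` (`[I_c P] = c`), else `0`. [cite: VignerasLNM800, Ch. III §5 exercice 5.8 (b)] -/
theorem XiSetup.matrix_ramified_diag (c : ClassSet S.O) :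
    matrix S.O p c c =
      if Quotient.mk (rightClassSetoid S.O) ⟨c.rep * normPrimeIdeal S.O p, S.rep_mul_normPrimeIdeal_mem c⟩ = c then 1 else 0 := by
  rw [S.matrix_ramified_apply c c]
  split_ifs with h1 h2 h2
  · rfl
  · exact absurd h1.symm h2
  · exact absurd h2.symm h1
  · rfl

end Brandt

end PrimeDiscriminant

end Literature.NumberTheory.Automorphic
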